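import Literature.NumberTheory.DiophantineGeometry.AbelianSchemeModelReductionTorsionBijective
import Literature.AlgebraicGeometry.AbelianSchemes.AbelianSchemeOverBase
import Literature.AlgebraicGeometry.AbelianSchemes.AbelianSchemeOverField
import HarnessLib

/-!
# `[N] : X → X` is unramified on an abelian scheme over a base on which `N` is invertible

Topic `AlgebraicGeometry/AbelianSchemes`; namespace `Literature.AlgebraicGeometry.AbelianSchemes.AbelianSchemeOver`;
THEOREMS ONLY (no definition, no named fact, no instance).  For an abelian scheme `A : AbelianSchemeOver S` over an
ARBITRARY base scheme `S` ([MumfordFogartyKirwan1994] Def. 6.1) and a natural number `N` invertible in every residue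
field of `S` (`∀ s, (N : κ(s)) ≠ 0`; e.g. `S` over a field of characteristic `0`), the `S`-endomorphism
«multiplication by `N`» `[N] := (𝟙 A.X) ^ N` (Mathlib's `Hom.group` power of the group object `A.X` of `Over S` — the
spelling of ★ `LevelStructure.pow_σ` and of ★ `IsAbelianSchemeModel.formallyUnramified_pow_id_left`) is
UNRAMIFIED: formally unramified and locally of finite type ([BLRNeronModels1990] §7.3 Prop. 2 / [GortzWedhorn2023]
Prop. 27.187: `[N]` is étale for `N` invertible on the base — here the unramified half, which is what the topological
consumers need: `[N](ℂ)` is then LOCALLY INJECTIVE, ★ `isLocallyInjective_map_of_formallyUnramified`).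

Proof = the tree's two-point-base argument ★ `IsAbelianSchemeModel.formallyUnramified_pow_id_left` run over EVERY point:
unramifiedness is fibrewise (★ `FormallyUnramified.of_formallyUnramified_fiberToSpecResidueField`, [EGAIV4] 17.4.1 /
Stacks 02G8); every `z ∈ X` lies in the fibre `X_s`, `s = π z`, whose inclusion `X_s = X ×_S Spec κ(s) → X` is
surjective on stalks (base change of the preimmersion `Spec κ(s) → S`), so the fibre of `[N]_X` over `z` IS the fibre of
`[N]_{X_s}` over the corresponding point (★ `formallyUnramified_fiberToSpecResidueField_of_isPullback` on ★
`isPullback_pullback_map_left`); and `[N]_{X_s}` is `[N]` of the abelian VARIETY `X_s / κ(s)` (the base-change functor is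
monoidal), étale because `N ≠ 0` in `κ(s)` (★ `AbelianVariety.etale_zsmul_id_holds`, [MumfordAV1970] §6 Appl. 3).

* `map_id_pow'` — a monoidal functor maps `(𝟙 X)^N` to `(𝟙 (F X))^N` (public twin of T1c's private lemma);
* `formallyUnramified_pullback_map_pow_id` — `[N]` on the fibre `X_s` is formally unramified (`(N : κ) ≠ 0`);
* `exists_fst_fromSpecResidueField_eq`, `formallyUnramified_fiberToSpecResidueField_pow_id` — every fibre of `[N]_X` is
  formally unramified;
* `locallyOfFiniteType_pow_id_left`, **`formallyUnramified_pow_id_left`** — `[N]` is locally of finite type and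
  formally unramified on `X`;
* **`formallyUnramified_pow_id_left_of_charZero`** (with the private helper `natCast_residueField_ne_zero_of_charZero`)
  — the form the moduli consumer instantiates: `S` a scheme over a field `K` of characteristic `0` (any
  `f : S ⟶ Spec K`) and `N ≠ 0`.

## References
* [BLRNeronModels1990] S. Bosch, W. Lütkebohmert, M. Raynaud, *Néron Models* (1990), §7.3 Prop. 2.
* [GortzWedhorn2023] U. Görtz, T. Wedhorn, *Algebraic Geometry II* (2023), Prop. 27.187.
* [MumfordAV1970] D. Mumford, *Abelian Varieties*, §6 Application 3 (Proposition p. 64).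
* [EGAIV4] A. Grothendieck, EGA IV₄, Publ. Math. IHÉS 32 (1967), Thm. 17.4.1, Prop. 17.3.3.
-/

set_option autoImplicit false

universe u

open CategoryTheory CategoryTheory.Limits AlgebraicGeometry MonoidalCategory
open scoped MonObj CategoryTheory.Obj

noncomputable section

namespace Literature.AlgebraicGeometry.AbelianSchemes

namespace AbelianSchemeOver

open Literature.AlgebraicGeometry.Motives (AbelianVariety)
open Literature.AlgebraicGeometry.Limits (isPullback_pullback_map_left)
open Literature.NumberTheory.DiophantineGeometry (formallyUnramified_fiberToSpecResidueField_of_isPullback)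

/-- A monoidal functor between cartesian-monoidal categories maps the power `(𝟙 X) ^ N` of the identity of a monoid
object (Mathlib's `Hom.monoid`) to `(𝟙 (F X)) ^ N` for the transported monoid structure (Mathlib
`Functor.homMonoidHom`). [cite: GortzWedhorn2020, Section (4.7) (pp. 107–108) (base change is a functor)] -/
theorem map_id_pow' {C D : Type*} [Category C] [Category D] [CartesianMonoidalCategory C]
    [CartesianMonoidalCategory D] (F : C ⥤ D) [F.Monoidal] (X : C) [MonObj X] (N : ℕ) :
    F.map ((𝟙 X : X ⟶ X) ^ N) = (𝟙 (F.obj X) : F.obj X ⟶ F.obj X) ^ N := by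
  rw [← F.homMonoidHom_apply, map_pow, F.homMonoidHom_apply, F.map_id]

variable {S : Scheme.{u}} (A : AbelianSchemeOver S)

/-- **`[N]` on a fibre `X_s` is formally unramified when `N ≠ 0` in the field**: for a field-valued point
`s : Spec K → S` with `(N : K) ≠ 0`, the base change `[N]_{X_s} = (Over.pullback s).map [N]_X` is `[N]` of the abelian
VARIETY `X_s` (the base-change functor is monoidal, `map_id_pow'`), which is étale ([MumfordAV1970] §6 Appl. 3: ★
`AbelianVariety.etale_zsmul_id_holds`), in particular formally unramified.
[cite: MumfordAV1970, §6 Application 3 (Proposition p. 64)] [cite: GortzWedhorn2023, Prop. 27.187] -/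
theorem formallyUnramified_pullback_map_pow_id {K : Type u} [Field K] (s : Spec (.of K) ⟶ S) {N : ℕ}
    (hN : (N : K) ≠ 0) :
    FormallyUnramified ((Over.pullback s).map ((𝟙 A.X : A.X ⟶ A.X) ^ N)).left := by
  have hN' : ((N : ℤ) : K) ≠ 0 := by rwa [Int.cast_natCast]
  have het := AbelianVariety.etale_zsmul_id_holds (A := (A.fibre s).toAbelianVariety) (N : ℤ) hN'
  have e1 : AbelianVariety.Hom.toSchemeHom ((N : ℤ) • 𝟙 (A.fibre s).toAbelianVariety) =
      ((Over.pullback s).map ((𝟙 A.X : A.X ⟶ A.X) ^ N)).left := by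
    change (((N : ℤ) • 𝟙 (A.fibre s).toAbelianVariety).hom.hom.hom).left = _
    rw [AbelianVariety.hom_zsmul_id, zpow_natCast, map_id_pow']
    rfl
  rw [e1] at het
  exact (Etale.iff_flat_and_formallyUnramified.mp het).2.1

/-- Every point `z` of `X` lies in the fibre over `s = π z`: it is in the image of the fibre inclusion
`X ×_S Spec κ(π z) → X` (Mathlib `Scheme.Pullback.range_fst`, `Scheme.range_fromSpecResidueField`).
[cite: GortzWedhorn2020, Section (4.8) (fibres of a morphism)] -/
theorem exists_fst_fromSpecResidueField_eq (X : Over S) (z : X.left) :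
    ∃ y, (pullback.fst X.hom (S.fromSpecResidueField (X.hom.base z))).base y = z := by
  have hmem : z ∈ Set.range ⇑(pullback.fst X.hom (S.fromSpecResidueField (X.hom.base z))) := by
    rw [Scheme.Pullback.range_fst, Set.mem_preimage, Scheme.range_fromSpecResidueField]
    exact Set.mem_singleton _
  exact hmem

/-- **The fibres of `[N]_X : X → X` are formally unramified** when `N ≠ 0` in every residue field of `S`: the fibre of
`[N]_X` over `z` is the fibre of `[N]_{X_s}` (`s = π z`) over the corresponding point of `X_s = X ×_S Spec κ(s)` — the
fibre inclusion is a base change of the preimmersion `Spec κ(s) → S`, hence surjective on stalks, so residue fields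
match (★ `formallyUnramified_fiberToSpecResidueField_of_isPullback`, [EGAIV4] 17.3.3 (iii)) — and `[N]_{X_s}` is
formally unramified (`formallyUnramified_pullback_map_pow_id`). [cite: EGAIV4, Prop. 17.3.3 (iii)]
[cite: MumfordAV1970, §6 Application 3 (Proposition p. 64)] -/
theorem formallyUnramified_fiberToSpecResidueField_fst_pow_id {N : ℕ} (s : S) (hN : (N : S.residueField s) ≠ 0)
    (y : ↥(pullback A.X.hom (S.fromSpecResidueField s))) :
    FormallyUnramified ((((𝟙 A.X : A.X ⟶ A.X) ^ N) : A.X ⟶ A.X).left.fiberToSpecResidueField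
      ((pullback.fst A.X.hom (S.fromSpecResidueField s)).base y)) := by
  have hg : SurjectiveOnStalks (pullback.fst A.X.hom (S.fromSpecResidueField s)) :=
    MorphismProperty.pullback_fst (P := @SurjectiveOnStalks) _ _
      (IsPreimmersion.toSurjectiveOnStalks (f := S.fromSpecResidueField s))
  exact formallyUnramified_fiberToSpecResidueField_of_isPullback
    (isPullback_pullback_map_left (S.fromSpecResidueField s) ((𝟙 A.X : A.X ⟶ A.X) ^ N)).flip
    hg (A.formallyUnramified_pullback_map_pow_id (S.fromSpecResidueField s) hN) y

/-- **Every fibre of `[N]_X : X → X` is formally unramified** when `N ≠ 0` in every residue field of `S` (each `z ∈ X`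
lies in the fibre `X_{π z}`, `exists_fst_fromSpecResidueField_eq`). [cite: EGAIV4, Prop. 17.3.3 (iii)]
[cite: MumfordAV1970, §6 Application 3 (Proposition p. 64)] -/
theorem formallyUnramified_fiberToSpecResidueField_pow_id {N : ℕ} (hN : ∀ s : S, (N : S.residueField s) ≠ 0)
    (z : A.X.left) :
    FormallyUnramified ((((𝟙 A.X : A.X ⟶ A.X) ^ N) : A.X ⟶ A.X).left.fiberToSpecResidueField z) := by
  obtain ⟨y, hy⟩ := exists_fst_fromSpecResidueField_eq A.X z
  rw [← hy]
  exact A.formallyUnramified_fiberToSpecResidueField_fst_pow_id (A.X.hom.base z) (hN _) y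

/-- **`[N]_X` is locally of finite type** (it is an `S`-morphism between schemes locally of finite type over `S`:
`[N] ≫ π = π` with `π` smooth; Mathlib `locallyOfFiniteType_of_comp`). [cite: GortzWedhorn2020, Prop. 10.7 (properties
of morphisms locally of finite type: cancellation)] -/
theorem locallyOfFiniteType_pow_id_left (N : ℕ) :
    LocallyOfFiniteType ((((𝟙 A.X : A.X ⟶ A.X) ^ N) : A.X ⟶ A.X).left) := by
  have hw : (((𝟙 A.X : A.X ⟶ A.X) ^ N) : A.X ⟶ A.X).left ≫ A.X.hom = A.X.hom := Over.w _
  haveI : Smooth A.X.hom := A.isSmooth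
  haveI : LocallyOfFiniteType ((((𝟙 A.X : A.X ⟶ A.X) ^ N) : A.X ⟶ A.X).left ≫ A.X.hom) := by
    rw [hw]; infer_instance
  exact locallyOfFiniteType_of_comp _ A.X.hom

/-- **`[N] : X → X` IS FORMALLY UNRAMIFIED on an abelian scheme over a base in whose residue fields `N ≠ 0`**
([BLRNeronModels1990] §7.3 Prop. 2, [GortzWedhorn2023] Prop. 27.187: «`[N]` is étale for `N` invertible on `S`»; the
unramified half): unramifiedness is fibrewise for morphisms locally of finite type (★
`FormallyUnramified.of_formallyUnramified_fiberToSpecResidueField`, [EGAIV4] 17.4.1 / Stacks 02G8) and the fibres are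
unramified (`formallyUnramified_fiberToSpecResidueField_pow_id`). [cite: BLRNeronModels1990, §7.3 Prop. 2]
[cite: GortzWedhorn2023, Prop. 27.187] [cite: EGAIV4, Thm. 17.4.1] -/
theorem formallyUnramified_pow_id_left {N : ℕ} (hN : ∀ s : S, (N : S.residueField s) ≠ 0) :
    FormallyUnramified ((((𝟙 A.X : A.X ⟶ A.X) ^ N) : A.X ⟶ A.X).left) := by
  haveI := A.locallyOfFiniteType_pow_id_left N
  exact Literature.AlgebraicGeometry.Morphisms.FormallyUnramified.of_formallyUnramified_fiberToSpecResidueField _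
    (A.formallyUnramified_fiberToSpecResidueField_pow_id hN)

/-- Over a field `K` of characteristic zero a nonzero natural number `N` is nonzero in every residue field `κ(s)` of
`S`: the structure map `K → κ(s)` (read off `Spec κ(s) → S → Spec K` by `Spec.preimage`) is a ring map out of a field
into a field, hence injective. [folklore] -/
private theorem natCast_residueField_ne_zero_of_charZero {K : Type u} [Field K] [CharZero K] (f : S ⟶ Spec (.of K))
    (s : S) {N : ℕ} (hN : N ≠ 0) : (N : S.residueField s) ≠ 0 := by
  let φ : K →+* S.residueField s := (Spec.preimage (S.fromSpecResidueField s ≫ f)).hom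
  rw [← map_natCast φ N]
  exact (map_ne_zero φ).mpr (Nat.cast_ne_zero.mpr hN)

/-- **`[N] : X → X` IS FORMALLY UNRAMIFIED on an abelian scheme over a base of characteristic zero** — the form the
moduli consumer instantiates (`S` a scheme over a field `K` with `CharZero K`, e.g. `K = ℂ`, via any `f : S ⟶ Spec K`;
`N ≠ 0`): the residue fields of `S` are `K`-algebras, so `(N : κ(s)) ≠ 0`
(`natCast_residueField_ne_zero_of_charZero`) and `formallyUnramified_pow_id_left` applies.
[cite: BLRNeronModels1990, §7.3 Prop. 2] [cite: GortzWedhorn2023, Prop. 27.187] -/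
theorem formallyUnramified_pow_id_left_of_charZero {K : Type u} [Field K] [CharZero K] (f : S ⟶ Spec (.of K))
    {N : ℕ} (hN : N ≠ 0) :
    FormallyUnramified ((((𝟙 A.X : A.X ⟶ A.X) ^ N) : A.X ⟶ A.X).left) :=
  A.formallyUnramified_pow_id_left fun s => natCast_residueField_ne_zero_of_charZero f s hN

end AbelianSchemeOver

end Literature.AlgebraicGeometry.AbelianSchemes

end
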